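import Summits.QuantumFields.YangMills.Theorems.BalabanUVNodesN15SiteCurvedColouredLayer
import Summits.QuantumFields.YangMills.Theorems.BalabanUVNodesN15SiteScalarLayerMassless
import HarnessLib

/-!
# Route «BalabanUVNodes», cluster K4 «SpineRates» — node N15 = NE2: THE SITE LAYER WITH THE BACKGROUND LIVE IN THE TwoGrid ENTRY CURRENCY, XXXV — THE COLOURED SITE-FORM DICTIONARY:
# the `U ≡ 1` coloured site form `siteForm₀ (liftMap B κ) (G ⊗ 1)` IS the colour-diagonal lift of the scalar one, the scalar one is INVARIANT under a relabelling of the fine carrier,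
# hence on part XXXIII's one-step King family (coarse `G′ ⊗ 1 = kingGT … 0`, fine `G′₁ ⊗ 1 = kingGT₁ … 0` on the NESTED torus) it IS `colDiag κ (qggqRe …)` — so part XXI's socket
# object `((Q′G′²Q′* ⊗ 1) + P_f(A′))⁻¹` at part XXXIII's `P_f = curvPf` IS LITERALLY the inverse of the coloured site form of the curved-dressed layer

Cell `pub-ymgap`, WIDTH SEAT `pub-ymgap-dag-n15-w1` (generation 4; director-ym №197 ∕ HUMAN RULING D-0149; chair R455 (A) ∕ R461; dag-lead KEY MAP v2 INBOX l.35754; own CLAIM line on the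
bus).  `bears_on: R4∕N15 · K3⁸ SpineGivenEndpointR13SepCoPHV (stmt-QuantumFields-27366; K3⁷ 20544 aside = lineage)`.  Filed `--kind proof --supports stmt-QuantumFields-27366 --as helper`
— COUNT-NEUTRAL.  THEOREMS ONLY (0 `def`, 0 `sorry`).  Imports BY NAME this seat's part XXXIII `…N15SiteCurvedColouredLayer` (`curvPf`, `curvPc`, `curvXfo`, `curvXco`, `curvCube`) and part
VII `…N15SiteScalarLayerMassless` (`siteEntries_siteForm₀_kingGOp_zero`: the scalar dictionary `siteEntries (siteForm₀ blockOf (kingGOp … 0 …)) = qggqRe`); dag-n15-c S2 `siteForm`∕`siteForm₀`,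
n15-b `fibAvg`, this seat's parts V∕XXI∕XXII `siteEntries`∕`colDiag`∕`siteEntriesC`∕`sitePertC`∕`siteExC`, dag-n15-e Ω-b `castT`∕`blockOf_comp_blockOf_eq`∕`kingGOp₁`, `blockOf_underPtN`;
nothing in the tree is modified.

WHY.  Part XXI's coloured socket `siteExC κ n a M P = (colDiag κ (qggqRe n a M) + P)⁻¹` takes the `U ≡ 1` coloured site form as the CLOSED FORM `colDiag κ (qggqRe …)` and the
perturbation `P` as data; part XXII∕XXXIII feed `P := siteEntriesC (sitePertC q (G ⊗ 1) X) = entries(siteForm q 0 0 X) − entries(siteForm₀ q (G ⊗ 1))`.  The object is the inverse of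
the GENUINE dressed coloured site form `Q X² Q*` exactly when `entries(siteForm₀ q (G ⊗ 1)) = colDiag κ (qggqRe …)` — part VII §4 proved the scalar identity on the flat carrier; THIS
FILE lifts it to colours (§1: the fibres of `liftMap B κ` are the fibres of `B` with the colour carried along, `(G ⊗ 1)` acts colour by colour) and transports it to the NESTED fine torus of
the one-step King family (§2: `siteForm₀` is invariant under relabelling the fine carrier by an `Equiv`, and `kingGT₁ = (castT-conjugate of kingGOp …) ⊗ 1`, `blockOf ∘ blockOf =
blockOf ∘ castT` by Ω-b), §3: the two dictionaries for part XXXIII's family and ★ the LITERAL reading of part XXXIII's socket object.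

CONTENTS.  §1 `fibre_liftMap_eq_map`, `tensorId_slice_fun`, ★ `siteEntriesC_siteForm₀_tensorId` (generic: `= colDiag κ (siteEntries (siteForm₀ B G))`); §2 `fibre_comp_equiv`,
`fibAvg_comp_equiv_pull`, ★ `siteForm₀_comp_equiv_conj` (generic relabelling invariance); §3 ★ `siteEntriesC_siteForm₀_kingGT_zero`, ★★ `siteEntriesC_siteForm₀_kingGT₁_zero`, ★★
`siteExC_curvPf_eq` ∕ `siteExC_curvPc_eq` (the socket objects of part XXXIII ARE `(entries (Q X′(A′)² Q*))⁻¹`, `(entries (Q X(Ā′)² Q*))⁻¹`).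

HONEST FRAMING ∕ LIMITS.  Count-neutral; [folklore] finite sums ∕ relabelling + two LANDED dictionaries by name; no estimate.  It only identifies WHICH operator part XXXIII's `NE2PlusSite`
speaks about (the inverse coloured site form of King's massless site propagator dressed by the exact adjoint transporter, `U ≡ 1` averaging `Q`); nothing of [B5]∕[B9] asserted ((1.45) p. 26,
Thm 3.2 (3.48) p. 398, (3.65) p. 403 = SHAPES).  NE2⁺ NOT PRINTED ∕ NOT proved; **N15 is NOT discharged**; K3⁸ OPEN, not claimed, skeleton v6 untouched; counts of record UNMOVED (typed 28∕28 ·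
discharged 5∕27, A 5∕28); one finite four-torus programme at fixed `ε` — NOT ℝ⁴, NOT infinite volume, NOT OS, NOT a mass gap, NOT Clay; R4 closes the conditional finite-𝕋⁴ rung
`BalabanLadder.UV` only.  Restate-immune (no Theses import).
-/

set_option autoImplicit false

noncomputable section
open scoped BigOperators Matrix Matrix.Norms.Frobenius

namespace Summit.QuantumFields.YangMills.BalabanUVNodes.N15.SiteLayerBg

open Finset
open Literature.MathematicalPhysics.QuantumFieldTheory.Balaban1983to89
open Literature.MathematicalPhysics.QuantumFieldTheory.Balaban1983to89.T4EtaRateCoeffDefect (pull pull_apply fibre mem_fibre)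
open Literature.MathematicalPhysics.QuantumFieldTheory.Balaban1983to89.T4EtaRateDefectSite (entry entry_apply)
open Literature.MathematicalPhysics.QuantumFieldTheory.Balaban1983to89.B5Prop11Plancherel (Tor fine)
open Literature.MathematicalPhysics.QuantumFieldTheory.Balaban1983to89.B5QGGQ145Bounds (Idx qggqRe)
open Literature.MathematicalPhysics.QuantumFieldTheory.Balaban1983to89.B5PBridgeProjection (torIdx)
open Literature.MathematicalPhysics.QuantumFieldTheory.King1986 (aK)
open Literature.MathematicalPhysics.QuantumFieldTheory.King1986.Torus (blockOf)
open Literature.Barriers.QuantumFields (traceForm)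
open Summit.QuantumFields.YangMills.BalabanUVNodes.N15.VectorPiece (tensorId tensorId_apply)
open Summit.QuantumFields.YangMills.BalabanUVNodes.N15.MatrixSpecies (liftMap liftBlk)
open Summit.QuantumFields.YangMills.BalabanUVNodes.N15.BackgroundLayer (fibAvg fibAvg_apply)
open Summit.QuantumFields.YangMills.BalabanUVNodes.N15.SiteLayer (siteForm siteForm₀)
open Summit.QuantumFields.YangMills.BalabanUVNodes.N15KingModelRung (KingVolIndex)
open Summit.QuantumFields.YangMills.BalabanUVNodes.N15KingModelRung.Curved

/-! ## §1 The coloured `U ≡ 1` site form is the colour-diagonal lift of the scalar one -/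

section Colour

variable {X Y : Type} [Fintype X] [Fintype Y] [DecidableEq Y] (κ : Type) [Fintype κ] [DecidableEq κ]

omit [Fintype Y] in
/-- The fibre of the colour-lifted map over `(y, c)` is the fibre of the map over `y` with the colour `c` attached. [folklore] -/
theorem fibre_liftMap_eq_map (B : X → Y) (y : Y) (c : κ) :
    fibre (liftMap B κ) (y, c) = (fibre B y).map ⟨fun x => (x, c), fun _ _ h => congrArg Prod.fst h⟩ := by
  ext p
  simp only [mem_fibre, Finset.mem_map, Function.Embedding.coeFn_mk, Prod.ext_iff]
  constructor
  · rintro ⟨h1, h2⟩; exact ⟨p.1, h1, rfl, h2.symm⟩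
  · rintro ⟨x, hx, h1, h2⟩; exact ⟨h1 ▸ hx, h2.symm⟩

omit [Fintype X] [Fintype κ] in
/-- `(G ⊗ 1)` applied to a colour-`c′` slice: `(G ⊗ 1)(f ⊗ δ_{c′}) = (Gf) ⊗ δ_{c′}`. [folklore] -/
theorem tensorId_slice_fun (G : (X → ℝ) →ₗ[ℝ] (X → ℝ)) (f : X → ℝ) (c' : κ) :
    tensorId κ G (fun q : X × κ => if q.2 = c' then f q.1 else 0) = fun p : X × κ => if p.2 = c' then G f p.1 else 0 := by
  funext p
  rw [tensorId_apply]
  by_cases h : p.2 = c'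
  · simp only [h, if_true]
  · simp only [h, if_false]
    have : (fun x : X => (0 : ℝ)) = 0 := rfl
    rw [this, map_zero, Pi.zero_apply]

variable {κ}

/-- ★ **THE COLOURED `U ≡ 1` SITE FORM IS THE COLOUR-DIAGONAL LIFT OF THE SCALAR ONE**: `entries(siteForm₀ (liftMap B κ) (G ⊗ 1)) = colDiag κ (entries(siteForm₀ B G))` on the unit-torus
sites `Idx M × κ`. [folklore] -/
theorem siteEntriesC_siteForm₀_tensorId {d : ℕ} (M : Fin (d + 1) → ℕ) [∀ μ, NeZero (M μ)] (B : X → Tor M) (G : (X → ℝ) →ₗ[ℝ] (X → ℝ)) :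
    siteEntriesC M κ (siteForm₀ (liftMap B κ) (tensorId κ G)) = colDiag κ (siteEntries M (siteForm₀ B G)) := by
  classical
  ext p q
  rw [siteEntriesC_apply, colDiag_apply, siteEntries_apply]
  -- the pulled-back indicator is a colour slice
  have hpull : pull (liftMap B κ) (Pi.single (((torIdx M).symm q.1, q.2) : Tor M × κ) (1 : ℝ)) =
      fun r : X × κ => if r.2 = q.2 then pull B (Pi.single ((torIdx M).symm q.1) (1 : ℝ)) r.1 else 0 := by
    funext r
    rw [pull_apply, pull_apply]
    by_cases h2 : r.2 = q.2
    · simp only [h2, if_true]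
      by_cases h1 : B r.1 = (torIdx M).symm q.1
      · rw [show liftMap B κ r = ((torIdx M).symm q.1, q.2) from Prod.ext h1 h2, Pi.single_eq_same, h1, Pi.single_eq_same]
      · rw [Pi.single_eq_of_ne (fun h => h1 (congrArg Prod.fst h)), Pi.single_eq_of_ne h1]
    · simp only [h2, if_false]
      exact Pi.single_eq_of_ne (fun h => h2 (congrArg Prod.snd h)) _
  simp only [siteForm₀, LinearMap.comp_apply]
  rw [hpull, tensorId_slice_fun, tensorId_slice_fun, fibAvg_apply, fibAvg_apply, fibre_liftMap_eq_map, Finset.card_map, Finset.sum_map]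
  simp only [Function.Embedding.coeFn_mk]
  by_cases hc : p.2 = q.2
  · simp only [hc, if_true]
  · simp only [hc, if_false, Finset.sum_const_zero, zero_div]

end Colour

/-! ## §2 The scalar `U ≡ 1` site form is invariant under relabelling the fine carrier -/

section Relabel

variable {X X' Y : Type} [Fintype X] [Fintype X'] [DecidableEq Y]

/-- Fibres relabel: `fibre (B ∘ σ) y = (fibre B y).map σ⁻¹`. [folklore] -/
theorem fibre_comp_equiv (B : X → Y) (σ : X' ≃ X) (y : Y) : fibre (B ∘ ⇑σ) y = (fibre B y).map σ.symm.toEmbedding := by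
  ext x'
  simp only [mem_fibre, Function.comp_apply, Finset.mem_map_equiv, Equiv.symm_symm]

/-- The fibre average over the relabelled carrier of a pulled-back function is the original fibre average. [folklore] -/
theorem fibAvg_comp_equiv_pull (B : X → Y) (σ : X' ≃ X) (f : X → ℝ) : fibAvg (B ∘ ⇑σ) (pull ⇑σ f) = fibAvg B f := by
  funext y
  rw [fibAvg_apply, fibAvg_apply, fibre_comp_equiv, Finset.card_map, Finset.sum_map]
  simp only [Equiv.coe_toEmbedding, pull_apply, Equiv.apply_symm_apply]

/-- ★ **RELABELLING INVARIANCE OF THE `U ≡ 1` SITE FORM**: `siteForm₀ (B ∘ σ) (σ*Gσ*⁻¹) = siteForm₀ B G` for an `Equiv` `σ` of the fine carriers (`σ* = pull σ`). [folklore] -/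
theorem siteForm₀_comp_equiv_conj (B : X → Y) (σ : X' ≃ X) (G : (X → ℝ) →ₗ[ℝ] (X → ℝ)) :
    siteForm₀ (B ∘ ⇑σ) (pull ⇑σ ∘ₗ G ∘ₗ pull ⇑σ.symm) = siteForm₀ B G := by
  have hpp : ∀ f : X → ℝ, pull (⇑σ.symm) (pull (⇑σ) f) = f := fun f => funext fun x => by rw [pull_apply, pull_apply, Equiv.apply_symm_apply]
  have hpq : ∀ v : Y → ℝ, pull (B ∘ ⇑σ) v = pull ⇑σ (pull B v) := fun v => rfl
  refine LinearMap.ext fun v => ?_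
  simp only [siteForm₀, LinearMap.comp_apply, hpq, hpp]
  exact fibAvg_comp_equiv_pull B σ (G (G (pull B v)))

end Relabel

/-! ## §3 The dictionaries of part XXXIII's family and the literal reading of its socket objects -/

section King

variable {d : ℕ} (L : ℕ) [NeZero L]
variable {n : Type} [Fintype n] [DecidableEq n] (κ : Type) [Fintype κ] [DecidableEq κ] (e : Matrix n n ℂ ≃L[ℝ] (κ → ℝ)) (a : ℝ)

/-- ★ COARSE DICTIONARY: `entries(siteForm₀ (liftMap blockOf κ) (G′ ⊗ 1)) = colDiag κ (qggqRe (L^K) (a_K) M)` for `G′ = kingGOp L a 0 K (L^K) M` (part VII §4 lifted to colours).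
[cite: Balaban1984PropagatorsI, (1.45) p.26 (`Q′G′²Q′*` at `U ≡ 1`)] -/
theorem siteEntriesC_siteForm₀_kingGT_zero (hL : 2 ≤ L) (ha : 0 < a) (i : KingVolIndex d) :
    siteEntriesC (curvCube L i) κ (siteForm₀ (liftMap (blockOf (L ^ i.K) (curvCube L i)) κ) (kingGT L a 0 i.K (curvCube L i) κ)) =
      colDiag κ (qggqRe (L ^ i.K) (aK a L i.K) (curvCube L i)) := by
  rw [kingGT, siteEntriesC_siteForm₀_tensorId, siteEntries_siteForm₀_kingGOp_zero (curvCube L i) L (by omega) ha i.one_le_K]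

/-- ★★ FINE DICTIONARY ON THE NESTED TORUS: `entries(siteForm₀ (liftMap (blockOf (L^K) ∘ blockOf L) κ) (G′₁ ⊗ 1)) = colDiag κ (qggqRe (L·L^K) (a_{K+1}) M)` for
`G′₁ = kingGT₁ L a 0 K M κ` — Ω-b's `kingGOp₁ = castT* ∘ kingGOp … (K+1) (L¹L^K) ∘ castT*⁻¹`, `blockOf ∘ blockOf = (blockOf ∘ underPtN) ∘ castT`, `blockOf ∘ underPtN = blockOf (L¹L^K)`, §2, §1, part VII §4.
[cite: Balaban1984PropagatorsI, (1.45) p.26; King1986, p.664 (pairing)] -/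
theorem siteEntriesC_siteForm₀_kingGT₁_zero (hL : 2 ≤ L) (ha : 0 < a) (i : KingVolIndex d) :
    siteEntriesC (curvCube L i) κ (siteForm₀ (liftMap (blockOf (L ^ i.K) (curvCube L i) ∘ blockOf L (fine (L ^ i.K) (curvCube L i))) κ) (kingGT₁ L a 0 i.K (curvCube L i) κ)) =
      colDiag κ (qggqRe (L ^ 1 * L ^ i.K) (aK a L (i.K + 1)) (curvCube L i)) := by
  rw [kingGT₁, siteEntriesC_siteForm₀_tensorId, blockOf_comp_blockOf_eq, kingGOp₁, siteForm₀_comp_equiv_conj]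
  have hb : blockOf (L ^ i.K) (curvCube L i) ∘ underPtN L i.K 1 (curvCube L i) = blockOf (L ^ 1 * L ^ i.K) (curvCube L i) :=
    funext fun x' => blockOf_underPtN L i.K 1 (curvCube L i) x'
  rw [hb, siteEntries_siteForm₀_kingGOp_zero (curvCube L i) L (by omega) ha (Nat.le_add_right 1 i.K |>.trans_eq (Nat.add_comm 1 i.K))]

/-- ★★ **THE LITERAL READING OF PART XXXIII's FINE SOCKET OBJECT**: `siteExC κ (L·L^K) (a_{K+1}) M (curvPf … A′) = (entries (siteForm (q ∘ π) 0 0 X′(A′)))⁻¹` — the inverse of the GENUINE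
coloured site form `Q X′(A′)² Q*` of the curved-dressed fine layer (`U ≡ 1` averaging `Q`). [cite: Balaban1985BackgroundPropagators, Thm 3.2 (3.48) p.398, (3.65) p.403 (shapes)] -/
theorem siteExC_curvPf_eq (hL : 2 ≤ L) (ha : 0 < a) (i : KingVolIndex d) (A' : (curvBgF L n i).Cfg) :
    siteExC κ (L ^ 1 * L ^ i.K) (aK a L (i.K + 1)) (curvCube L i) (curvPf L κ e a i A') =
      (siteEntriesC (curvCube L i) κ (siteForm (liftMap (blockOf (L ^ i.K) (curvCube L i) ∘ blockOf L (fine (L ^ i.K) (curvCube L i))) κ) 0 0 (curvXfo L κ e a i A')))⁻¹ := by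
  rw [siteExC_eq, curvPf, sitePertC_eq, siteEntriesC_sub, ← siteEntriesC_siteForm₀_kingGT₁_zero L κ a hL ha i, add_sub_cancel]

/-- ★★ THE SAME FOR THE COARSE SOCKET OBJECT: `siteExC κ (L^K) (a_K) M (curvPc … V) = (entries (siteForm q 0 0 X(V)))⁻¹`. [cite: Balaban1985BackgroundPropagators, Thm 3.2 (3.48) p.398, (3.65) p.403 (shapes)] -/
theorem siteExC_curvPc_eq (hL : 2 ≤ L) (ha : 0 < a) (i : KingVolIndex d) (V : (curvBgC L n i).Cfg) :
    siteExC κ (L ^ i.K) (aK a L i.K) (curvCube L i) (curvPc L κ e a i V) =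
      (siteEntriesC (curvCube L i) κ (siteForm (liftMap (blockOf (L ^ i.K) (curvCube L i)) κ) 0 0 (curvXco L κ e a i V)))⁻¹ := by
  rw [siteExC_eq, curvPc, sitePertC_eq, siteEntriesC_sub, ← siteEntriesC_siteForm₀_kingGT_zero L κ a hL ha i, add_sub_cancel]

end King

end Summit.QuantumFields.YangMills.BalabanUVNodes.N15.SiteLayerBg

end
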